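import Summits.CriticalPhenomena.PercolationContinuityZ3.Theorems.PercNearOneGluingNoHeavyLowerTailSunflowerBipartiteSymmetrisation
import Summits.CriticalPhenomena.PercolationContinuityZ3.Theorems.PercNearOneGluingNoHeavyLowerTailSunflowerGraphCoreTriangle
import HarnessLib

/-!
# `NoHeavyLowerTail` (crux stmt-CriticalPhenomena-4575), abstract sunflower cubic: BIPARTITE GRAPH CORES ARE A-SAFE — part 3: CONDITIONING on one side — the type-model instance

Support file (seat `prim-ineq-prove-1` gen 40; `--supports stmt-CriticalPhenomena-4575`).  No `sorry`, no named facts.  Memo: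
run/shared/lean/prim/prim-ineq-prove-1/FINDING-BIPARTITE-prove1-g40.md (§1 polarisation, §2 symmetrisation, §3 conditioning, §4 the
type-model lemma = `TypeModel.Model.typeModel_lemma` of `…SunflowerTypeModelLemma`).

THE THEOREM (file `…SunflowerBipartiteSafe`, `Bridge.safe_edgeCore_of_bipartite`): **every bipartite graph core is safe for every
parameter vector** — if `L` is one side of a bipartition of `Γ : SimpleGraph (Fin n)` then `SafeCalc.Safe p (SafeCalc.edgeCore Γ)` for all
`p`, i.e. Lemma A `∏_k μ_p(V k) ≤ μ_p(A)^(K−1)` for every number `K` of petals (g39's conjecture `TriangleFreeSafe` on the bipartite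
stratum: all trees, even cycles, grids, cubes, `K_{a,b}` minus anything, …).

THIS FILE (§3 of the memo).  For one side `L` of a bipartition and up-sets `V k` meeting pairwise in the core (`Hyp`): the petal parts
`Wof Γ V k = V k ∖ A`, the R-vertex type `Rv L`, L-parts `Cpart`, rows `rowOf`, gluing `glue`/`row_glue`; the cross-edge lemmas
(`union_mem_edgeCore_of_mem_Wof`, `exists_cross_edge`), ONE LABEL PER SLOT (`eq_of_rowOf_mem_Wof`), the label `labOf`, killer types
`τOf`, the orientation `OOf` and COMPATIBILITY `OOf_or_OOf` (memo §3(iii)), the instance **`modelOf`** : `TypeModel.Model K (Rv L) (Fin K)`,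
and the transports `rowOf_mem_edgeCore_iff` (A-slot ⟺ row in the core), `isP_of_rowOf_mem_Wof`, `nonA_modelOf_eq_J`, `bad_of_badG`,
`goodG_of_good`.
-/

namespace Summit.CriticalPhenomena.PercolationContinuityZ3.Theorems.SunflowerPartition

namespace Bridge

open Finset MeasureTheory Literature.Probability.LatticeModels Literature.Probability.Percolation

variable {K n : ℕ}

/-! ### G3: conditioning on one side of a bipartite graph — the `TypeModel.Model` instance -/

section Conditioning

variable (Γ : SimpleGraph (Fin n)) (L : Finset (Fin n)) (V : Fin K → Set (Set (Fin n)))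

/-- The petal part of `V k`: `W k = V k ∖ A`. -/
def Wof (k : Fin K) : Set (Set (Fin n)) := V k \ SafeCalc.edgeCore Γ

/-- The R-side vertex type. -/
abbrev Rv (L : Finset (Fin n)) := {x : Fin n // x ∉ L}

/-- The L-part of row `k` under the L-assignment `SL`. -/
def Cpart (SL : Fin n → Finset (Fin K)) (k : Fin K) : Set (Fin n) := {u | u ∈ L ∧ k ∈ SL u}

/-- The row of slot `k` assembled from the L-part `SL` and an R-assignment `T`. -/
def rowOf (SL : Fin n → Finset (Fin K)) (T : Rv L → Finset (Fin K)) (k : Fin K) : Set (Fin n) :=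
  Cpart L SL k ∪ {v | ∃ x : Rv L, k ∈ T x ∧ x.1 = v}

/-- Gluing an L-part and an R-assignment into a global assignment. -/
def glue (SL : Fin n → Finset (Fin K)) (T : Rv L → Finset (Fin K)) : Fin n → Finset (Fin K) :=
  fun x => if h : x ∈ L then SL x else T ⟨x, h⟩

/-- The rows of a glued assignment are the rows assembled from its L-part and R-part. [this work] -/
theorem row_glue (SL : Fin n → Finset (Fin K)) (T : Rv L → Finset (Fin K)) (k : Fin K) :
    row (glue L SL T) k = rowOf L SL T k := by
  ext v
  simp only [row, glue, Set.mem_setOf_eq, rowOf, Cpart, Set.mem_union]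
  by_cases hv : v ∈ L
  · simp only [hv, dif_pos, true_and]
    constructor
    · intro h; exact Or.inl h
    · rintro (h | ⟨x, -, hx⟩)
      · exact h
      · exact absurd (hx ▸ hv) x.2
  · simp only [hv, dif_neg, not_false_eq_true, false_and, false_or]
    constructor
    · intro h; exact ⟨⟨v, hv⟩, h, rfl⟩
    · rintro ⟨x, hx, rfl⟩; exact hx

/-- The hypotheses of the conditioning step: `L` is one side of a bipartition of `Γ`, the `V k` are up-sets meeting pairwise
inside the core. -/
structure Hyp : Prop where
  bip : ∀ u v, Γ.Adj u v → (u ∈ L ↔ v ∉ L)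
  up : ∀ k, IsUpperSet (V k)
  cap : ∀ i j, i ≠ j → V i ∩ V j ⊆ SafeCalc.edgeCore Γ

variable {Γ L V}

/-- Members of distinct petals are cross-edged: their union lies in the core. -/
theorem union_mem_edgeCore_of_mem_Wof (H : Hyp Γ L V) {a b : Fin K} (hab : a ≠ b) {α β : Set (Fin n)}
    (hα : α ∈ Wof Γ V a) (hβ : β ∈ Wof Γ V b) : α ∪ β ∈ SafeCalc.edgeCore Γ :=
  H.cap a b hab ⟨H.up a Set.subset_union_left hα.1, H.up b Set.subset_union_right hβ.1⟩

/-- A cross edge between members of distinct petals: an edge `u ~ v` with `u ∈ α ∖ β` and `v ∈ β ∖ α`. -/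
theorem exists_cross_edge (H : Hyp Γ L V) {a b : Fin K} (hab : a ≠ b) {α β : Set (Fin n)}
    (hα : α ∈ Wof Γ V a) (hβ : β ∈ Wof Γ V b) : ∃ u v, Γ.Adj u v ∧ u ∈ α ∧ u ∉ β ∧ v ∈ β ∧ v ∉ α := by
  obtain ⟨u, v, huv, hu, hv⟩ := union_mem_edgeCore_of_mem_Wof H hab hα hβ
  have hnα : ¬ (u ∈ α ∧ v ∈ α) := fun h => hα.2 ⟨u, v, huv, h.1, h.2⟩
  have hnβ : ¬ (u ∈ β ∧ v ∈ β) := fun h => hβ.2 ⟨u, v, huv, h.1, h.2⟩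
  rcases hu with hu | hu <;> rcases hv with hv | hv
  · exact absurd ⟨hu, hv⟩ hnα
  · exact ⟨u, v, huv, hu, fun h => hnβ ⟨h, hv⟩, hv, fun h => hnα ⟨hu, h⟩⟩
  · exact ⟨v, u, huv.symm, hv, fun h => hnβ ⟨hu, h⟩, hu, fun h => hnα ⟨h, hv⟩⟩
  · exact absurd ⟨hu, hv⟩ hnβ

variable (Γ L V) (SL : Fin n → Finset (Fin K))

/-- ONE LABEL PER SLOT: two R-completions of the same L-part of a slot cannot lie in distinct petals. -/
theorem eq_of_rowOf_mem_Wof (H : Hyp Γ L V) {k : Fin K} {T T' : Rv L → Finset (Fin K)} {j j' : Fin K}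
    (hj : rowOf L SL T k ∈ Wof Γ V j) (hj' : rowOf L SL T' k ∈ Wof Γ V j') : j = j' := by
  by_contra hne
  obtain ⟨u, v, huv, hu, hnu, hv, hnv⟩ := exists_cross_edge H hne hj hj'
  -- both u and v are R-vertices (the L-parts coincide), contradicting bipartiteness
  have huL : u ∉ L := by
    intro huL
    apply hnu
    rcases hu with hu | ⟨x, -, hx⟩
    · exact Or.inl hu
    · exact absurd (hx ▸ huL) x.2
  have hvL : v ∉ L := by
    intro hvL
    apply hnv
    rcases hv with hv | ⟨x, -, hx⟩
    · exact Or.inl hv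
    · exact absurd (hx ▸ hvL) x.2
  exact huL ((H.bip u v huv).2 hvL)

/-- The label of slot `k`: the (unique) petal index having a nonempty section over the L-part, if any. -/
noncomputable def labOf (k : Fin K) : Option (Fin K) := by
  classical
  exact if h : ∃ j, ∃ T : Rv L → Finset (Fin K), rowOf L SL T k ∈ Wof Γ V j then some (Classical.choose h) else none

/-- If some R-completion of slot `k` lies in petal `j`, the label of `k` is `j` (one label per slot). [this work] -/
theorem labOf_eq_some (H : Hyp Γ L V) {k j : Fin K} {T : Rv L → Finset (Fin K)} (h : rowOf L SL T k ∈ Wof Γ V j) :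
    labOf Γ L V SL k = some j := by
  classical
  unfold labOf
  have hex : ∃ j, ∃ T : Rv L → Finset (Fin K), rowOf L SL T k ∈ Wof Γ V j := ⟨j, T, h⟩
  rw [dif_pos hex]
  obtain ⟨T', hT'⟩ := Classical.choose_spec hex
  rw [eq_of_rowOf_mem_Wof Γ L V SL H hT' h]

/-- A slot has no label iff no R-completion of its L-part lies in any petal. [this work] -/
theorem labOf_eq_none_iff {k : Fin K} :
    labOf Γ L V SL k = none ↔ ∀ j (T : Rv L → Finset (Fin K)), rowOf L SL T k ∉ Wof Γ V j := by
  classical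
  unfold labOf
  constructor
  · intro h j T hT
    have hex : ∃ j, ∃ T : Rv L → Finset (Fin K), rowOf L SL T k ∈ Wof Γ V j := ⟨j, T, hT⟩
    rw [dif_pos hex] at h; exact Option.some_ne_none _ h
  · intro h
    rw [dif_neg]
    rintro ⟨j, T, hT⟩; exact h j T hT

/-- The killer type of an R-vertex: the slots whose L-part contains a neighbour. -/
noncomputable def τOf (x : Rv L) : Finset (Fin K) := by
  classical exact univ.filter fun k => ∃ u, u ∈ L ∧ k ∈ SL u ∧ Γ.Adj u x.1

omit V in
/-- Membership in the killer type: `k ∈ τ x` iff `x` has a neighbour in the L-part of slot `k`. [this work] -/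
theorem mem_τOf {x : Rv L} {k : Fin K} : k ∈ τOf Γ L SL x ↔ ∃ u, u ∈ L ∧ k ∈ SL u ∧ Γ.Adj u x.1 := by
  classical
  unfold τOf; simp

/-- The orientation: `OOf l k` — labels present and distinct, and every petal-row of slot `k` has an `F_l`-element in its R-part. -/
def OOf (l k : Fin K) : Prop :=
  ∃ a b, labOf Γ L V SL k = some a ∧ labOf Γ L V SL l = some b ∧ a ≠ b ∧
    ∀ T : Rv L → Finset (Fin K), rowOf L SL T k ∈ Wof Γ V a → ∃ x : Rv L, k ∈ T x ∧ l ∈ τOf Γ L SL x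

/-- COMPATIBILITY (memo §3(iii)): slots with distinct labels are joined by an arc of the orientation. -/
theorem OOf_or_OOf (H : Hyp Γ L V) {k l : Fin K} (hk : labOf Γ L V SL k ≠ none)
    (hl : labOf Γ L V SL l ≠ none) (hne : labOf Γ L V SL k ≠ labOf Γ L V SL l) :
    OOf Γ L V SL k l ∨ OOf Γ L V SL l k := by
  classical
  obtain ⟨a, ha⟩ := Option.ne_none_iff_exists'.1 hk
  obtain ⟨b, hb⟩ := Option.ne_none_iff_exists'.1 hl
  have hab : a ≠ b := by intro h; apply hne; rw [ha, hb, h]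
  by_contra hno
  push Not at hno
  obtain ⟨h1, h2⟩ := hno
  have h1' : ∃ T' : Rv L → Finset (Fin K), rowOf L SL T' l ∈ Wof Γ V b ∧ ∀ x : Rv L, l ∈ T' x → k ∉ τOf Γ L SL x := by
    by_contra h; push Not at h
    exact h1 ⟨b, a, hb, ha, hab.symm, fun T' hT' => h T' hT'⟩
  have h2' : ∃ T : Rv L → Finset (Fin K), rowOf L SL T k ∈ Wof Γ V a ∧ ∀ x : Rv L, k ∈ T x → l ∉ τOf Γ L SL x := by
    by_contra h; push Not at h
    exact h2 ⟨a, b, ha, hb, hab, fun T hT => h T hT⟩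
  obtain ⟨T', hT', hno1⟩ := h1'
  obtain ⟨T, hT, hno2⟩ := h2'
  obtain ⟨u, v, huv, hu, hnu, hv, hnv⟩ := exists_cross_edge H hab hT hT'
  by_cases huL : u ∈ L
  · -- u ∈ C k, v is an R-vertex of row l
    have hvL : v ∉ L := (H.bip u v huv).1 huL
    have hku : k ∈ SL u := by
      rcases hu with hu | ⟨x, -, hx⟩
      · exact hu.2
      · exact absurd (hx ▸ huL) x.2
    obtain ⟨x, hlx, hxv⟩ : ∃ x : Rv L, l ∈ T' x ∧ x.1 = v := by
      rcases hv with hv | h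
      · exact absurd hv.1 hvL
      · exact h
    apply hno1 x hlx
    rw [mem_τOf]
    exact ⟨u, huL, hku, hxv ▸ huv⟩
  · have hvL : v ∈ L := (H.bip v u huv.symm).2 huL
    have hlv : l ∈ SL v := by
      rcases hv with hv | ⟨x, -, hx⟩
      · exact hv.2
      · exact absurd (hx ▸ hvL) x.2
    obtain ⟨x, hkx, hxu⟩ : ∃ x : Rv L, k ∈ T x ∧ x.1 = u := by
      rcases hu with hu | h
      · exact absurd hu.1 huL
      · exact h
    apply hno2 x hkx
    rw [mem_τOf]
    exact ⟨v, hvL, hlv, hxu ▸ huv.symm⟩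

/-- **The type-model instance** of the L-part `SL`. [this work] -/
noncomputable def modelOf (H : Hyp Γ L V) : TypeModel.Model K (Rv L) (Fin K) := by
  classical exact
  { τ := τOf Γ L SL
    lab := labOf Γ L V SL
    O := OOf Γ L V SL
    arc := fun k l _ hk hl hne => OOf_or_OOf Γ L V SL H hk hl hne }

/-! #### Transport between the global BAD/GOOD and the model's Bad/Good -/

/-- A row lies in the core iff its slot is an A-slot of the model (memo §3(i)). [this work] -/
theorem rowOf_mem_edgeCore_iff (H : Hyp Γ L V) (T : Rv L → Finset (Fin K)) (k : Fin K) :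
    rowOf L SL T k ∈ SafeCalc.edgeCore Γ ↔ (modelOf Γ L V SL H).IsA T k := by
  constructor
  · rintro ⟨u, v, huv, hu, hv⟩
    -- one endpoint is in L (in the L-part), the other is an R-vertex of the row
    by_cases huL : u ∈ L
    · have hvL : v ∉ L := (H.bip u v huv).1 huL
      have hku : k ∈ SL u := by
        rcases hu with hu | ⟨x, -, hx⟩
        · exact hu.2
        · exact absurd (hx ▸ huL) x.2
      obtain ⟨x, hkx, hxv⟩ : ∃ x : Rv L, k ∈ T x ∧ x.1 = v := by
        rcases hv with hv | h
        · exact absurd hv.1 hvL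
        · exact h
      refine ⟨x, hkx, ?_⟩
      show k ∈ τOf Γ L SL x
      rw [mem_τOf]; exact ⟨u, huL, hku, hxv ▸ huv⟩
    · have hvL : v ∈ L := (H.bip v u huv.symm).2 huL
      have hkv : k ∈ SL v := by
        rcases hv with hv | ⟨x, -, hx⟩
        · exact hv.2
        · exact absurd (hx ▸ hvL) x.2
      obtain ⟨x, hkx, hxu⟩ : ∃ x : Rv L, k ∈ T x ∧ x.1 = u := by
        rcases hu with hu | h
        · exact absurd hu.1 huL
        · exact h
      refine ⟨x, hkx, ?_⟩
      show k ∈ τOf Γ L SL x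
      rw [mem_τOf]; exact ⟨v, hvL, hkv, hxu ▸ huv.symm⟩
  · rintro ⟨x, hkx, hkt⟩
    change k ∈ τOf Γ L SL x at hkt
    rw [mem_τOf] at hkt
    obtain ⟨u, huL, hku, hux⟩ := hkt
    exact ⟨u, x.1, hux, Or.inl ⟨huL, hku⟩, Or.inr ⟨x, hkx, rfl⟩⟩

/-- A row lying in a petal makes its slot a P-slot of the model. -/
theorem isP_of_rowOf_mem_Wof (H : Hyp Γ L V) {T : Rv L → Finset (Fin K)} {k j : Fin K}
    (h : rowOf L SL T k ∈ Wof Γ V j) : (modelOf Γ L V SL H).IsP T k := by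
  refine ⟨fun hA => h.2 ((rowOf_mem_edgeCore_iff Γ L V SL H T k).2 hA), ?_, ?_⟩
  · show labOf Γ L V SL k ≠ none
    rw [labOf_eq_some Γ L V SL H h]; exact Option.some_ne_none _
  · rintro l ⟨a, b, hka, -, -, hwit⟩
    change labOf Γ L V SL k = some a at hka
    rw [labOf_eq_some Γ L V SL H h] at hka
    obtain rfl : j = a := Option.some_injective _ hka
    exact hwit T h

/-- The model's non-A set is the set of independent rows of the glued configuration. -/
theorem nonA_modelOf_eq_J (H : Hyp Γ L V) (T : Rv L → Finset (Fin K)) :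
    (modelOf Γ L V SL H).nonA T = J (SafeCalc.edgeCore Γ) (glue L SL T) := by
  ext k
  rw [TypeModel.Model.mem_nonA, mem_J, row_glue, rowOf_mem_edgeCore_iff Γ L V SL H T k]

/-- Global BAD ⟹ model Bad. -/
theorem bad_of_badG (H : Hyp Γ L V) {T : Rv L → Finset (Fin K)}
    (hb : BadG (SafeCalc.edgeCore Γ) (Wof Γ V) (glue L SL T)) : (modelOf Γ L V SL H).Bad T := by
  obtain ⟨h2, f, hfinj, hf⟩ := hb
  rw [← nonA_modelOf_eq_J Γ L V SL H T] at h2 hfinj hf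
  refine ⟨h2, fun k hk => ?_, fun k hk l hl hkl => ?_⟩
  · have := hf k hk; rw [row_glue] at this
    exact isP_of_rowOf_mem_Wof Γ L V SL H this
  · have hk' := hf k hk; have hl' := hf l hl
    rw [row_glue] at hk' hl'
    show labOf Γ L V SL k ≠ labOf Γ L V SL l
    rw [labOf_eq_some Γ L V SL H hk', labOf_eq_some Γ L V SL H hl']
    intro h
    exact hkl (hfinj hk hl (Option.some_injective _ h))

/-- Model Good ⟹ global GOOD. -/
theorem goodG_of_good (H : Hyp Γ L V) {T : Rv L → Finset (Fin K)} (hg : (modelOf Γ L V SL H).Good T) :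
    GoodG (SafeCalc.edgeCore Γ) (Wof Γ V) (glue L SL T) := by
  obtain ⟨z, hz, hnp⟩ := hg
  refine ⟨z, ?_, fun j hj => hnp ?_⟩
  · rw [← nonA_modelOf_eq_J Γ L V SL H T, hz]
  · rw [row_glue] at hj
    exact isP_of_rowOf_mem_Wof Γ L V SL H hj

end Conditioning


end Bridge

end Summit.CriticalPhenomena.PercolationContinuityZ3.Theorems.SunflowerPartition
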